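import Summits.ResolutionOfSingularities.ResolutionOfSingularities.Theorems.EquisingularLiftEquisingularLiftNatTowerReachSsDefs
import Summits.ResolutionOfSingularities.ResolutionOfSingularities.Theorems.EquisingularLiftEquisingularLiftNatSpecimenWhitneyCubicCiNose
import Summits.ResolutionOfSingularities.ResolutionOfSingularities.Theorems.EquisingularLiftEquisingularLiftNatSpecimenSkewLinesLiftableNoseClass
import Summits.ResolutionOfSingularities.ResolutionOfSingularities.Theorems.EquisingularLiftEquisingularLiftNatLiftableNoseClass2Defs
import Summits.ResolutionOfSingularities.ResolutionOfSingularities.Theorems.EquisingularLiftEquisingularLiftNatRationalCarrierInfinite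
import Summits.ResolutionOfSingularities.ResolutionOfSingularities.Theorems.EquisingularLiftEquisingularLiftNatStalkDimension
import Summits.ResolutionOfSingularities.ResolutionOfSingularities.Theorems.EquisingularLiftEquisingularLiftNatCarrierCurveDimension
import Literature.AlgebraicGeometry.Motives.VarietiesProjectiveSpaceProofs
import HarnessLib

/-!
# [OURS · L1 W4.5(b) · EL♮(3)] NOSE ENGINE CERTIFICATION ‖ K — the B‴ nose-chain predicate `ReachNoseTowerBTriplePrime` HOLDS on a specimen:
# the zero-round certificate schema + its line lemmas + the FIRST KERNEL INSTANCE (the Whitney-type cubic `x₁x₂² = x₀x₃²`, every field)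

Cell `res-hironaka`, rung L, slot W4.5(b); crux **EL♮(3)** = `EquisingularLiftNatThree` (stmt-ResolutionOfSingularities-20148; parent EL♮
stmt-…-20038), line `sections`, CHILD skeleton v40 5c495a9882932dfd. Width seat res-L1-w45b-nose-w3 (D-0157 (A) DOOR 1), row «nose-w3 := NOSE
ENGINE CERTIFICATION ‖ K» of res-L1-w45b-plan-1's WIDTH TABLE D1 (2026-08-28T14:38:46Z). `--supports stmt-ResolutionOfSingularities-20148 --as
helper`; closes nothing. OURS; NOT a statement of any manuscript; AI-written, weaker than expert review. No definition, no `sorry`, standard axioms.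
HONESTY: resolution of surfaces in positive characteristic (dimension 3 ambient) is a theorem in print (Cossart–Piltant 2008/2009); this is OUR
kernel-own bookkeeping for the chain's engine predicate, counted 0 toward the summit; nothing of [Hironaka2017] is used or asserted.

WHAT. The registered nose residue `stub_elnat_three_nonisolated_nonDefNoseTowerBTriplePrime` carries `¬ ReachNoseTowerBTriplePrime k n H ι`
(res-L1-w45b-lead-2's (D‴6), `…NatTowerReachSsDefs` p628165): «some closed curve `Z` of the liftable nose class₂ inside `ι(H)` whose blow-up,
followed by the B‴ round phase (`TowerPtRegB₄` / `TowerPtRamB₄` / `TowerRoundBTriplePrime`), reaches a stage with regular reduced strict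
transform». Until now NO specimen inhabited any `ReachNoseTower…` predicate in the kernel (the engine files are upstairs closures). This file:

* `reachNoseTowerBTriplePrime_of_oneBlowup` — **THE ZERO-ROUND CERTIFICATE SCHEMA** (any field `k`, any `n`, any `H`, `ι`): if `Z` is closed, in
  `IsLiftableNoseClass₂`, `Z ⊆ ι(H) ⊄ Z`, infinite, with one-dimensional local rings at the closed points of `Z_red`, and for SOME blow-up `υ` of
  `𝓘⟨Z⟩` the reduced strict transform `(closure υ⁻¹(ι(H) ∖ Z))_red` is regular, then `ReachNoseTowerBTriplePrime k n H ι` (empty round phase: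
  `F' = F₂`, `γ' = 𝟙`, lists `[]`/`[]`, `K' = ∅`; pure logic + `closure_closure`). Every «one nose blow-up resolves» specimen is certified by
  discharging these five concrete clauses.
* `doubleLine_infinite`, `doubleLine_curve` — the two NEW clauses for the coordinate line `Σ = V(x₂, x₃) ⊂ ℙ³_k` (any field): `Σ` is infinite
  (it is the range of the kill-map closed immersion `ℙ¹_k ↪ ℙ³_k`, res-D-pv-013 `range_projMap_kill_eq_doubleLine`, and `ℙ¹_k` is infinite,
  res-L1-w45b-lead-2 `infinite_projectiveLine`) and the closed points of `Σ_red ≅ ℙ¹_k` (Mathlib `IsIso f.toImage` for the closed immersion, pv-013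
  `ker_projMap_kill_eq_vanishingIdeal_doubleLine`) have one-dimensional local rings (`ℙ¹_k → Spec k` smooth of relative dimension 1,
  `isSmoothProjective_projectiveSpace_holds`; res-D-pv-013 `ringKrullDim_stalk_eq_of_smoothOfRelativeDimension_of_isClosed`; transport
  res-L1-w45b-stub-3 `forall_ringKrullDim_stalk_eq_of_iso`).
* **`WhitneyCubic.reachNoseTowerBTriplePrime_whitneyCubic`** — **THE FIRST KERNEL INSTANCE OF THE B‴ NOSE PREDICATE**: for R2's Whitney-type cubic
  `H = V₊(x₁x₂² − x₀x₃²) ⊂ ℙ³_K` (res-D-pv-022, ANY field `K`, every characteristic incl. `2`), `ReachNoseTowerBTriplePrime K 3 H ι` with `Z = Σ` the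
  double line: class₂ by `base ∘ SkewLines.line_isLiftableNoseClass` (res-type-051), incidences and the blow-up by res-D-pv-013's CI-nose certificate
  lemmas, regularity of the reduced strict transform by `LinearCentre.isRegular_reducedStrictTransform_of_blowupModel` over pv-022's
  `WhitneyCubic.isRegular_of_isBlowup_comap` (every blow-up of `H` along `Λ·𝒪_H` is regular).

CENSUS (typed ≠ proved; the by-name list asked by the desk row, classes of PLANNER-MEMO-g10-1 43…/CRUX-PLAN v3.44 §1): certified HERE — R2 Whitney-type
cubic (class v6 CI-nose; zero rounds). Certifiable by THIS schema once their chart algebra is typed (not in the tree today) — C0a «two skew double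
lines» quartics (`Z = V(x₀,x₁) ∪ V(x₂,x₃)`, class₂ by `SkewLines.skewLines_isLiftableNoseClass`; transversal `A₁`, one blow-up resolves), smooth
rational double curves with transversal `A₁` and Whitney pinches (class₂ `rat`). NOT certifiable by the zero-round schema (need ≥ 1 round of
`TowerRoundBTriplePrime` = kernel chart algebra of a second blow-up, size L per specimen) — C2 transversal `A₃` along a line (`x²q₂ + xy²ℓ + y⁴ + …`),
C0c vertical double fibres. OUTSIDE `ReachNoseTowerBTriplePrime` BY DESIGN (no point prefix before the nose blow-up; `Z` must be class₂ = smooth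
ci / det / Veronese-rational / disjoint unions) — C1 Steiner's Roman surface and Plücker-type concurrent double lines (singular `Γ`), C3b/C3c
positive-genus or special-embedding carriers: these are the residue's content, not certification targets.
-/

set_option linter.dupNamespace false -- mandated namespace `Summit.<Summit>.<Problem>` of this single-conjunct summit

noncomputable section

open CategoryTheory CategoryTheory.Limits AlgebraicGeometry TopologicalSpace
open MvPolynomial HomogeneousLocalization
open Literature.AlgebraicGeometry.Resolution
open Literature.AlgebraicGeometry.Motives Literature.AlgebraicGeometry.Motives.SmoothHypersurface
open Literature.AlgebraicGeometry.Motives.ProjectiveSpace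
open AlgebraicGeometry.Scheme.IdealSheafData

namespace Summit.ResolutionOfSingularities.ResolutionOfSingularities.Cruxes.EquisingularLiftNat.Sections

/-! ## The zero-round certificate schema -/

/-- **ZERO-ROUND CERTIFICATE SCHEMA for `ReachNoseTowerBTriplePrime`** (any field, any `n`): a closed `Z` of the liftable nose class₂ with
`Z ⊆ ι(H)`, `ι(H) ⊄ Z`, `Z` infinite, one-dimensional local rings at the closed points of `Z_red`, and ONE blow-up `υ` of `𝓘⟨Z⟩` whose reduced strict
transform `(closure υ⁻¹(ι(H) ∖ Z))_red` is regular, give `ReachNoseTowerBTriplePrime k n H ι` — the round phase is EMPTY (`F' = F₂`, `γ' = 𝟙 F₂`,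
`T' = closure υ⁻¹(ι(H) ∖ Z)`, `E' = υ⁻¹ Z`, `Es' = Ns' = []`, `K' = ∅`: the motive's base clause is the conclusion), and `closure (closure T') = closure T'`.
[OURS · L1 W4.5b · pure logic] -/
theorem reachNoseTowerBTriplePrime_of_oneBlowup (k : Type) [Field k] (n : ℕ) (H : Scheme.{0})
    (ι : H ⟶ (Literature.AlgebraicGeometry.Motives.projectiveSpace n k).left)
    (Z : Set (Literature.AlgebraicGeometry.Motives.projectiveSpace n k).left) (hZ : IsClosed Z)
    (hcls : IsLiftableNoseClass₂ k n Z) (hsub : Z ⊆ Set.range ι) (hnot : ¬ (Set.range ι ⊆ Z)) (hinf : Z.Infinite)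
    (hcurve : ∀ z : ↥(redSub (Literature.AlgebraicGeometry.Motives.projectiveSpace n k).left Z hZ),
      IsClosed ({z} : Set ↥(redSub (Literature.AlgebraicGeometry.Motives.projectiveSpace n k).left Z hZ)) →
        ringKrullDim ((redSub (Literature.AlgebraicGeometry.Motives.projectiveSpace n k).left Z hZ).presheaf.stalk z) =
          ((1 : ℕ) : WithBot ℕ∞))
    (F₂ : Scheme.{0}) (υ : F₂ ⟶ (Literature.AlgebraicGeometry.Motives.projectiveSpace n k).left)
    (hυ : IsBlowup υ (vanishingIdeal (⟨Z, hZ⟩ : Closeds (Literature.AlgebraicGeometry.Motives.projectiveSpace n k).left)))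
    (hreg : Scheme.IsRegular (redSub F₂ (closure (υ ⁻¹' (Set.range ι \ Z))) isClosed_closure)) :
    ReachNoseTowerBTriplePrime k n H ι := by
  refine ⟨Z, hZ, hcls, hsub, hnot, hinf, hcurve, F₂, υ, hυ, F₂, 𝟙 F₂, closure (υ ⁻¹' (Set.range ι \ Z)), υ ⁻¹' Z, [], [], ∅,
    fun R h0 _ _ _ => h0, ?_⟩
  have e : (⟨closure (closure (υ ⁻¹' (Set.range ι \ Z))), isClosed_closure⟩ : Closeds F₂) =
      ⟨closure (υ ⁻¹' (Set.range ι \ Z)), isClosed_closure⟩ := Closeds.ext closure_closure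
  change Scheme.IsRegular (vanishingIdeal (⟨closure (closure (υ ⁻¹' (Set.range ι \ Z))), isClosed_closure⟩ : Closeds F₂)).subscheme
  rw [e]
  exact hreg

/-! ## The coordinate line `Σ = V(x₂, x₃) ⊂ ℙ³_k`: infinite, and a curve -/

namespace WhitneyCubic

variable (K : Type) [Field K]

/-- **`Σ = V(x₂, x₃)` is infinite**: it is the range of the kill-map closed immersion `Proj(f_K) : ℙ¹_K ↪ ℙ³_K` (res-D-pv-013), and `ℙ¹_K` is
infinite over every field (res-L1-w45b-lead-2 `infinite_projectiveLine`). [OURS · elementary] -/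
theorem doubleLine_infinite :
    (letI := MvPolynomial.gradedAlgebra (σ := Fin (3 + 1)) (R := K);
      {y : (Literature.AlgebraicGeometry.Motives.projectiveSpace 3 K).left |
        ∀ i, (![X 2, X 3] : Fin 2 → MvPolynomial (Fin (3 + 1)) K) i ∈
          (y : ProjectiveSpectrum (MvPolynomial.homogeneousSubmodule (Fin (3 + 1)) K)).asHomogeneousIdeal}).Infinite := by
  classical
  letI := MvPolynomial.gradedAlgebra (σ := Fin (1 + 2 + 1)) (R := K)
  letI := MvPolynomial.gradedAlgebra (σ := Fin (1 + 1)) (R := K)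
  obtain ⟨fk, hfk', hfkC, hfkX⟩ := EquisingularLift.StrataSplit.LinearCentre.exists_kill K 1 2
  rw [← range_projMap_kill_eq_doubleLine K fk hfk' hfkC hfkX]
  haveI : IsClosedImmersion (Proj.map fk hfk') :=
    Literature.AlgebraicGeometry.FundamentalGroup.isClosedImmersion_projMap_of_surjective fk hfk'
      (EquisingularLift.StrataSplit.LinearCentre.kill_surjective (r := 1) (m := 2) fk.toRingHom (fun a => hfkC a)
        (fun i => hfkX i))
  haveI : Infinite ↥(Proj (homogeneousSubmodule (Fin (1 + 1)) K)) := infinite_projectiveLine K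
  exact Set.infinite_range_of_injective (Proj.map fk hfk').isClosedEmbedding.injective

/-- **`Σ = V(x₂, x₃)` is a curve**: the closed points of the reduced line `Σ_red` have one-dimensional local rings — `Σ_red ≅ ℙ¹_K` (the kill map
is a closed immersion from the reduced `ℙ¹_K` with kernel `𝓘⟨Σ⟩`, res-D-pv-013; Mathlib `IsIso f.toImage`), and the closed points of `ℙ¹_K`, smooth of
relative dimension `1` over `K`, have one-dimensional local rings (res-D-pv-013 T-DIM). [OURS · elementary; cite: GortzWedhorn2020, Lemma 6.26] -/
theorem doubleLine_curve :
    ∀ z : ↥(redSub (Literature.AlgebraicGeometry.Motives.projectiveSpace 3 K).left _ (isClosed_doubleLine K)),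
      IsClosed ({z} : Set ↥(redSub (Literature.AlgebraicGeometry.Motives.projectiveSpace 3 K).left _ (isClosed_doubleLine K))) →
        ringKrullDim ((redSub (Literature.AlgebraicGeometry.Motives.projectiveSpace 3 K).left _ (isClosed_doubleLine K)).presheaf.stalk z) =
          ((1 : ℕ) : WithBot ℕ∞) := by
  classical
  letI := MvPolynomial.gradedAlgebra (σ := Fin (1 + 2 + 1)) (R := K)
  letI := MvPolynomial.gradedAlgebra (σ := Fin (1 + 1)) (R := K)
  obtain ⟨fk, hfk', hfkC, hfkX⟩ := EquisingularLift.StrataSplit.LinearCentre.exists_kill K 1 2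
  haveI : IsClosedImmersion (Proj.map fk hfk') :=
    Literature.AlgebraicGeometry.FundamentalGroup.isClosedImmersion_projMap_of_surjective fk hfk'
      (EquisingularLift.StrataSplit.LinearCentre.kill_surjective (r := 1) (m := 2) fk.toRingHom (fun a => hfkC a)
        (fun i => hfkX i))
  -- closed points of `ℙ¹_K` have one-dimensional local rings
  haveI : SmoothOfRelativeDimension 1 (Literature.AlgebraicGeometry.Motives.projectiveSpace 1 K).hom :=
    (Literature.AlgebraicGeometry.Motives.isSmoothProjective_projectiveSpace_holds K 1).smoothOfRelativeDimension
  have hP1 : ∀ c : ↥(Proj (homogeneousSubmodule (Fin (1 + 1)) K)), IsClosed ({c} : Set _) →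
      ringKrullDim ((Proj (homogeneousSubmodule (Fin (1 + 1)) K)).presheaf.stalk c) = ((1 : ℕ) : WithBot ℕ∞) := fun c hc =>
    ringKrullDim_stalk_eq_of_smoothOfRelativeDimension_of_isClosed
      (Literature.AlgebraicGeometry.Motives.projectiveSpace 1 K).hom 1 hc
  -- transport along `ℙ¹_K ≅ V(ker)`, for every ideal sheaf equal to the kernel
  have key : ∀ (I : ((Literature.AlgebraicGeometry.Motives.projectiveSpace 3 K).left).IdealSheafData),
      (Proj.map fk hfk').ker = I → ∀ z : ↥I.subscheme, IsClosed ({z} : Set ↥I.subscheme) →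
        ringKrullDim (I.subscheme.presheaf.stalk z) = ((1 : ℕ) : WithBot ℕ∞) := by
    rintro I rfl
    exact forall_ringKrullDim_stalk_eq_of_iso (inv (Proj.map fk hfk').toImage) hP1
  exact key _ (ker_projMap_kill_eq_vanishingIdeal_doubleLine K fk hfk' hfkC hfkX (isClosed_doubleLine K))

/-! ## The first kernel instance: the Whitney-type cubic -/

/-- **THE B‴ NOSE PREDICATE HOLDS FOR THE WHITNEY-TYPE CUBIC** `H = V₊(x₁x₂² − x₀x₃²) ⊂ ℙ³_K` (res-D-pv-022's R2 specimen; ANY field `K`, every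
characteristic): `ReachNoseTowerBTriplePrime K 3 H ι` with the nose `Z = Σ = V(x₂, x₃)` (the double line = `Sing H`), ONE blow-up of `𝓘⟨Σ⟩` and an
EMPTY round phase — `Σ` is class₂ (`base ∘ SkewLines.line_isLiftableNoseClass`), `Σ ⊆ ι(H) ⊄ Σ` (pv-013), infinite and a curve (above), and the reduced
strict transform under any blow-up of `𝓘⟨Σ⟩ = ker Proj(f_K)` is regular (`LinearCentre.isRegular_reducedStrictTransform_of_blowupModel` over pv-022's
`isRegular_of_isBlowup_comap`). First kernel inhabitant of any `ReachNoseTower…` predicate of the chain. [OURS · L1 W4.5b] -/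
theorem reachNoseTowerBTriplePrime_whitneyCubic :
    ReachNoseTowerBTriplePrime K 3 (hypersurface (form K)).left (hypersurfaceι (form K)).left := by
  classical
  letI := MvPolynomial.gradedAlgebra (σ := Fin (1 + 2 + 1)) (R := K)
  letI := MvPolynomial.gradedAlgebra (σ := Fin (1 + 1)) (R := K)
  obtain ⟨fk, hfk', hfkC, hfkX⟩ := EquisingularLift.StrataSplit.LinearCentre.exists_kill K 1 2
  haveI := isIntegral_hypersurface K
  haveI : IsLocallyNoetherian (Literature.AlgebraicGeometry.Motives.projectiveSpace (2 + 1) K).left :=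
    EquisingularLift.StrataSplit.LinearCentre.isLocallyNoetherian_proj K (1 + 2)
  -- a blow-up of `ℙ³_K` along `Λ = ker Proj(f_K) = 𝓘(Σ)`
  obtain ⟨F₂, υ, hυ⟩ := exists_isBlowup (Proj (homogeneousSubmodule (Fin (1 + 2 + 1)) K)) (Proj.map fk hfk').ker
  have hΛ := ker_projMap_kill_eq_vanishingIdeal_doubleLine K fk hfk' hfkC hfkX (isClosed_doubleLine K)
  have hsupp := support_ker_projMap_kill_eq_doubleLine K fk hfk' hfkC hfkX
  -- the reduced strict transform is regular
  have hreg : Scheme.IsRegular (vanishingIdeal (⟨closure (υ ⁻¹' (Set.range (hypersurfaceι (form K)).left \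
      ((Proj.map fk hfk').ker.support : Set (Proj (homogeneousSubmodule (Fin (1 + 2 + 1)) K))))), isClosed_closure⟩ :
      Closeds F₂)).subscheme :=
    EquisingularLift.StrataSplit.LinearCentre.isRegular_reducedStrictTransform_of_blowupModel (hypersurfaceι (form K)).left
      (Proj.map fk hfk').ker (not_range_subset_support K fk hfk' hfkC hfkX)
      (fun Z ρ hρ => isRegular_of_isBlowup_comap K fk hfk' hfkC hfkX Z ρ hρ) υ hυ
  rw [hsupp] at hreg
  rw [hΛ] at hυ
  exact reachNoseTowerBTriplePrime_of_oneBlowup K 3 _ (hypersurfaceι (form K)).left _ (isClosed_doubleLine K)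
    (IsLiftableNoseClass₂.base _ (SkewLines.line_isLiftableNoseClass K 2 3 0 (by decide) (by decide) (by decide)))
    (doubleLine_subset_range_ι K) (not_range_ι_subset_doubleLine K) (doubleLine_infinite K) (doubleLine_curve K) F₂ υ hυ hreg

end WhitneyCubic

end Summit.ResolutionOfSingularities.ResolutionOfSingularities.Cruxes.EquisingularLiftNat.Sections

end
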